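import Summits.CriticalPhenomena.PercolationContinuityZ3.Theorems.PercNearOneGluingNoHeavyLowerTailKnQuestion8CoefficientwiseCoreClassDomLeafClusters
import HarnessLib

/-!
# KB-MIX: a mixed-level form of the core-class kernel that survives terminal leaves

Support file (`--supports stmt-CriticalPhenomena-4575`, closed), prover `prim-cplus-coupling` (gen 31).  No definitions, no notations, no named facts,
no sorries; standard axioms.  Memo `prim-cplus-coupling/A5-COUPLING-gen31.md` §1.  Companions `…CoreClassDom` (THEOREM KB-DOM), `…CoreClassDomLeaf`
(THEOREM LEAF), `…CoreClassKernelMixTransfer`, `…CoreClassKernelMixLeaf`, `…CoreClassKernelMixMain`.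

Setting: a finite multigraph `ends : ι → Sym2 V`, middle graph `E` with terminals `a, b`; colourings `ω ⊆ E` (red) / `E ∖ ω` (blue);
`R_v(ω) = C_v(ω)`, `B_v(ω) = C_v(E ∖ ω)`, `P = R_a`, `Q = B_b`, `S = R_a ∪ R_b`, wall event `T = {b ∉ R_a} ∩ {b ∉ B_a}`, and `ℜ = {b ∈ R_a}`
(`a, b` red-joined; there `S = R_a = R_b`).

KB-MIX (the invariant; used only as an explicit inequality, never defined).  For test functions `h, k` and LEVELS `hᵃ, hᵇ ≤ h`, `kᵃ, kᵇ ≤ k`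
(all monotone, nonnegative):
  `Σ_{ω ⊆ E : b ∉ R_a} h(S) k(S) + Σ_{ω ∈ T} (hᵃ(P) − hᵇ(Q)) (kᵃ(P) − kᵇ(Q)) ≥ 0`.                                                        (KB-MIX)
Compared with the core-class kernel (KB) the Harris supply is restricted OFF `ℜ` and the anti-term carries different levels on the `P`- and `Q`-sides —
exactly the two features the one-leaf step of THEOREM LEAF consumes and reproduces (memo §1).
* `Coefficientwise.kernelMix_pointwise` — the elementary inequality `w w' + u u' − v u' − u v' ≥ 0` for `0 ≤ u ≤ w`, `v ≤ w`, `0 ≤ u' ≤ w'`, `v' ≤ w'`.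
* `Coefficientwise.coreClass_kernelMix_comm` — (KB-MIX) for `(E; b, a)` with the levels exchanged IS (KB-MIX) for `(E; a, b)` (colour swap on `T`).
* `Coefficientwise.coreClass_kernelMix_of_properDom` — a PROPER domination map of `(E; a, b)` (THEOREM LEAF's hypothesis) gives (KB-MIX) for all levels.
* `Coefficientwise.coreClass_kernel_nonneg_of_kernelMix` — (KB-MIX) at equal levels `hᵃ = hᵇ = f`, `kᵃ = kᵇ = g − g ∅` gives the core-class kernel
  `Σ_ω f(S)(g S − g ∅) + Σ_T [f(R_a)(g R_a − g B_b) + f(R_b)(g R_b − g B_a)] ≥ 0`, hence CW-PA on the core class (`…CoreClassKernelWrapper`).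
The leaf step `(KB-MIX)(E; a, b) ⟹ (KB-MIX)(a′a + E; a′, b)` is `…CoreClassKernelMixLeaf`; with `_comm` it iterates at BOTH terminals, which THEOREM LEAF
(domination maps) could not: the seven taut two-terminal graphs on 8 vertices without a domination map (memo gen 30 §2.3, leaf–bundle–leaf) are covered.
[cite: KozmaNitzan2024, Questions 8–9 (§5.5 p. 36) (context: the Question-8 pocket covariance programme)]
-/

namespace Summit.CriticalPhenomena.PercolationContinuityZ3.Theorems

open Finset Literature.Probability.Percolation

namespace Coefficientwise

variable {ι V : Type*}

/-- Pointwise inequality behind the KB-MIX leaf step: if `0 ≤ u ≤ w`, `v ≤ w`, `0 ≤ u' ≤ w'`, `v' ≤ w'` then `0 ≤ w w' + u u' − v u' − u v'`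
(indeed `≥ (w − u)(w' − u')`). [cite: KozmaNitzan2024, §5.5 (context only; elementary)] -/
theorem kernelMix_pointwise {w u v w' u' v' : ℝ} (hu : 0 ≤ u) (huw : u ≤ w) (hvw : v ≤ w) (hu' : 0 ≤ u') (huw' : u' ≤ w')
    (hvw' : v' ≤ w') : 0 ≤ w * w' + u * u' - v * u' - u * v' := by
  have h1 : v * u' ≤ w * u' := mul_le_mul_of_nonneg_right hvw hu'
  have h2 : u * v' ≤ u * w' := mul_le_mul_of_nonneg_left hvw' hu
  have h3 : 0 ≤ (w - u) * (w' - u') := mul_nonneg (by linarith) (by linarith)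
  have h4 : (w - u) * (w' - u') = w * w' - w * u' - u * w' + u * u' := by ring
  linarith

open Classical in
/-- **KB-MIX is symmetric in the terminals.**  The KB-MIX expression of `(E; b, a)` with levels `(hᵇ, hᵃ; kᵇ, kᵃ)` equals the KB-MIX expression of
`(E; a, b)` with levels `(hᵃ, hᵇ; kᵃ, kᵇ)`: the supply index sets `{a ∉ R_b} = {b ∉ R_a}` and the wall events coincide, and the colour swap `ω ↦ E ∖ ω`
on the wall turns `(R_b, B_a)` into `(B_b, R_a)`. [cite: KozmaNitzan2024, Questions 8–9 (§5.5 p. 36) (context)] -/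
theorem coreClass_kernelMix_comm (ends : ι → Sym2 V) (E : Finset ι) (a b : V) (h k ha hb ka kb : Set V → ℝ) :
    ((∑ ω ∈ E.powerset.filter (fun ω : Finset ι => a ∉ openCluster (ends '' (↑ω : Set ι)) b),
        h (openCluster (ends '' (↑ω : Set ι)) b ∪ openCluster (ends '' (↑ω : Set ι)) a) *
          k (openCluster (ends '' (↑ω : Set ι)) b ∪ openCluster (ends '' (↑ω : Set ι)) a))
      + ∑ ω ∈ E.powerset.filter (fun ω : Finset ι => a ∉ openCluster (ends '' (↑ω : Set ι)) b ∧ a ∉ openCluster (ends '' (↑(E \ ω) : Set ι)) b),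
        (hb (openCluster (ends '' (↑ω : Set ι)) b) - ha (openCluster (ends '' (↑(E \ ω) : Set ι)) a)) *
          (kb (openCluster (ends '' (↑ω : Set ι)) b) - ka (openCluster (ends '' (↑(E \ ω) : Set ι)) a)))
    = (∑ ω ∈ E.powerset.filter (fun ω : Finset ι => b ∉ openCluster (ends '' (↑ω : Set ι)) a),
        h (openCluster (ends '' (↑ω : Set ι)) a ∪ openCluster (ends '' (↑ω : Set ι)) b) *
          k (openCluster (ends '' (↑ω : Set ι)) a ∪ openCluster (ends '' (↑ω : Set ι)) b))
      + ∑ ω ∈ E.powerset.filter (fun ω : Finset ι => b ∉ openCluster (ends '' (↑ω : Set ι)) a ∧ b ∉ openCluster (ends '' (↑(E \ ω) : Set ι)) a),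
        (ha (openCluster (ends '' (↑ω : Set ι)) a) - hb (openCluster (ends '' (↑(E \ ω) : Set ι)) b)) *
          (ka (openCluster (ends '' (↑ω : Set ι)) a) - kb (openCluster (ends '' (↑(E \ ω) : Set ι)) b)) := by
  set C : Finset ι → V → Set V := fun ω v => openCluster (ends '' (↑ω : Set ι)) v with hC
  change ((∑ ω ∈ E.powerset.filter (fun ω : Finset ι => a ∉ C ω b), h (C ω b ∪ C ω a) * k (C ω b ∪ C ω a))
      + ∑ ω ∈ E.powerset.filter (fun ω : Finset ι => a ∉ C ω b ∧ a ∉ C (E \ ω) b), (hb (C ω b) - ha (C (E \ ω) a)) * (kb (C ω b) - ka (C (E \ ω) a)))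
    = (∑ ω ∈ E.powerset.filter (fun ω : Finset ι => b ∉ C ω a), h (C ω a ∪ C ω b) * k (C ω a ∪ C ω b))
      + ∑ ω ∈ E.powerset.filter (fun ω : Finset ι => b ∉ C ω a ∧ b ∉ C (E \ ω) a), (ha (C ω a) - hb (C (E \ ω) b)) * (ka (C ω a) - kb (C (E \ ω) b))
  have hidx1 : E.powerset.filter (fun ω : Finset ι => a ∉ C ω b) = E.powerset.filter (fun ω : Finset ι => b ∉ C ω a) := by
    ext ω; simp only [Finset.mem_filter, hC, mem_openCluster_comm ends ω a b]
  have hidx2 : E.powerset.filter (fun ω : Finset ι => a ∉ C ω b ∧ a ∉ C (E \ ω) b) =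
      E.powerset.filter (fun ω : Finset ι => b ∉ C ω a ∧ b ∉ C (E \ ω) a) := by
    ext ω; simp only [Finset.mem_filter, hC, mem_openCluster_comm ends ω a b, mem_openCluster_comm ends (E \ ω) a b]
  rw [hidx1, hidx2]
  congr 1
  · exact Finset.sum_congr rfl fun ω _ => by rw [Set.union_comm]
  · have hsw := sum_powerset_filter_sdiff E (fun ω : Finset ι => b ∉ C ω a ∧ b ∉ C (E \ ω) a)
      (fun s hs => by rw [Finset.sdiff_sdiff_eq_self hs]; exact and_comm)
      (fun ω => (hb (C (E \ ω) b) - ha (C ω a)) * (kb (C (E \ ω) b) - ka (C ω a)))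
    have e1 : ∑ ω ∈ E.powerset.filter (fun ω : Finset ι => b ∉ C ω a ∧ b ∉ C (E \ ω) a),
        (hb (C ω b) - ha (C (E \ ω) a)) * (kb (C ω b) - ka (C (E \ ω) a)) =
        ∑ ω ∈ E.powerset.filter (fun ω : Finset ι => b ∉ C ω a ∧ b ∉ C (E \ ω) a),
          (hb (C (E \ (E \ ω)) b) - ha (C (E \ ω) a)) * (kb (C (E \ (E \ ω)) b) - ka (C (E \ ω) a)) := by
      refine Finset.sum_congr rfl fun ω hω => ?_
      rw [Finset.mem_filter, Finset.mem_powerset] at hω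
      rw [Finset.sdiff_sdiff_eq_self hω.1]
    rw [e1, hsw]
    exact Finset.sum_congr rfl fun ω _ => by ring

open Classical in
/-- **KB-MIX from a proper domination map.**  Middle graph `E`, terminals `a, b`, a map `ψ` with `ψ ω ⊆ E`, injective on the wall event
`{b ∉ C_a ω, b ∉ C_a(E∖ω)}`, `C_a ω ∪ C_b(E∖ω) ⊆ C_a(ψω) ∪ C_b(ψω)` and `b ∉ C_a(ψ ω)` there (a PROPER domination map).  Then for all monotone `h, k`
and levels `0 ≤ hᵃ, hᵇ ≤ h`, `0 ≤ kᵃ, kᵇ ≤ k`: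
`0 ≤ Σ_{ω ⊆ E : b ∉ C_a ω} h(C_a ω ∪ C_b ω) k(C_a ω ∪ C_b ω) + Σ_{ω : b ∉ C_a ω, b ∉ C_a(E∖ω)} (hᵃ(C_a ω) − hᵇ(C_b(E∖ω)))(kᵃ(C_a ω) − kᵇ(C_b(E∖ω)))`.
[cite: KozmaNitzan2024, Questions 8–9 (§5.5 p. 36) (context)] -/
theorem coreClass_kernelMix_of_properDom (ends : ι → Sym2 V) (E : Finset ι) (a b : V) (h k ha hb ka kb : Set V → ℝ)
    (hh : Monotone h) (hk : Monotone k)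
    (ha0 : ∀ X, 0 ≤ ha X) (hah : ∀ X, ha X ≤ h X) (hb0 : ∀ X, 0 ≤ hb X) (hbh : ∀ X, hb X ≤ h X)
    (ka0 : ∀ X, 0 ≤ ka X) (kak : ∀ X, ka X ≤ k X) (kb0 : ∀ X, 0 ≤ kb X) (kbk : ∀ X, kb X ≤ k X)
    (ψ : Finset ι → Finset ι)
    (hψE : ∀ ω, ω ⊆ E → b ∉ openCluster (ends '' (↑ω : Set ι)) a → b ∉ openCluster (ends '' (↑(E \ ω) : Set ι)) a → ψ ω ⊆ E)
    (hψcov : ∀ ω, ω ⊆ E → b ∉ openCluster (ends '' (↑ω : Set ι)) a → b ∉ openCluster (ends '' (↑(E \ ω) : Set ι)) a →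
      openCluster (ends '' (↑ω : Set ι)) a ∪ openCluster (ends '' (↑(E \ ω) : Set ι)) b ⊆
        openCluster (ends '' (↑(ψ ω) : Set ι)) a ∪ openCluster (ends '' (↑(ψ ω) : Set ι)) b)
    (hψinj : ∀ ω₁ ω₂, ω₁ ⊆ E → b ∉ openCluster (ends '' (↑ω₁ : Set ι)) a → b ∉ openCluster (ends '' (↑(E \ ω₁) : Set ι)) a →
      ω₂ ⊆ E → b ∉ openCluster (ends '' (↑ω₂ : Set ι)) a → b ∉ openCluster (ends '' (↑(E \ ω₂) : Set ι)) a → ψ ω₁ = ψ ω₂ → ω₁ = ω₂)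
    (hψprop : ∀ ω, ω ⊆ E → b ∉ openCluster (ends '' (↑ω : Set ι)) a → b ∉ openCluster (ends '' (↑(E \ ω) : Set ι)) a →
      b ∉ openCluster (ends '' (↑(ψ ω) : Set ι)) a) :
    0 ≤ (∑ ω ∈ E.powerset.filter (fun ω : Finset ι => b ∉ openCluster (ends '' (↑ω : Set ι)) a),
        h (openCluster (ends '' (↑ω : Set ι)) a ∪ openCluster (ends '' (↑ω : Set ι)) b) *
          k (openCluster (ends '' (↑ω : Set ι)) a ∪ openCluster (ends '' (↑ω : Set ι)) b))
      + ∑ ω ∈ E.powerset.filter (fun ω : Finset ι => b ∉ openCluster (ends '' (↑ω : Set ι)) a ∧ b ∉ openCluster (ends '' (↑(E \ ω) : Set ι)) a),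
        (ha (openCluster (ends '' (↑ω : Set ι)) a) - hb (openCluster (ends '' (↑(E \ ω) : Set ι)) b)) *
          (ka (openCluster (ends '' (↑ω : Set ι)) a) - kb (openCluster (ends '' (↑(E \ ω) : Set ι)) b)) := by
  set C : Finset ι → V → Set V := fun ω v => openCluster (ends '' (↑ω : Set ι)) v with hC
  set T : Finset (Finset ι) := E.powerset.filter (fun ω => b ∉ C ω a ∧ b ∉ C (E \ ω) a) with hT
  change 0 ≤ (∑ ω ∈ E.powerset.filter (fun ω : Finset ι => b ∉ C ω a), h (C ω a ∪ C ω b) * k (C ω a ∪ C ω b))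
    + ∑ ω ∈ T, (ha (C ω a) - hb (C (E \ ω) b)) * (ka (C ω a) - kb (C (E \ ω) b))
  have hTmem : ∀ {ω}, ω ∈ T ↔ ω ⊆ E ∧ b ∉ C ω a ∧ b ∉ C (E \ ω) a := fun {ω} => by
    rw [hT, Finset.mem_filter, Finset.mem_powerset]
  have hh0 : ∀ X, 0 ≤ h X := fun X => le_trans (ha0 X) (hah X)
  have hk0 : ∀ X, 0 ≤ k X := fun X => le_trans (ka0 X) (kak X)
  set Y : Finset ι → ℝ := fun ω => h (C ω a ∪ C ω b) * k (C ω a ∪ C ω b) with hY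
  have hY0 : ∀ ω, 0 ≤ Y ω := fun ω => mul_nonneg (hh0 _) (hk0 _)
  -- termwise on the wall, against the supply at `ψ ω`
  have step : 0 ≤ ∑ ω ∈ T, ((ha (C ω a) - hb (C (E \ ω) b)) * (ka (C ω a) - kb (C (E \ ω) b)) + Y (ψ ω)) := by
    refine Finset.sum_nonneg fun ω hω => ?_
    obtain ⟨s1, r1, b1⟩ := hTmem.mp hω
    have hcov := hψcov ω s1 r1 b1
    have hPa : C ω a ⊆ C (ψ ω) a ∪ C (ψ ω) b := fun y hy => hcov (Or.inl hy)
    have hQb : C (E \ ω) b ⊆ C (ψ ω) a ∪ C (ψ ω) b := fun y hy => hcov (Or.inr hy)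
    have := mul_add_sub_mul_sub_nonneg (A := h (C (ψ ω) a ∪ C (ψ ω) b)) (B := k (C (ψ ω) a ∪ C (ψ ω) b))
      (α := ha (C ω a)) (β := hb (C (E \ ω) b)) (γ := ka (C ω a)) (δ := kb (C (E \ ω) b))
      (ha0 _) (le_trans (hah _) (hh hPa)) (hb0 _) (le_trans (hbh _) (hh hQb))
      (ka0 _) (le_trans (kak _) (hk hPa)) (kb0 _) (le_trans (kbk _) (hk hQb))
    simp only [hY]; linarith
  -- the supply off `ℜ` dominates its part on `ψ(T)`
  have lower : ∑ ω ∈ T, Y (ψ ω) ≤ ∑ ω ∈ E.powerset.filter (fun ω : Finset ι => b ∉ C ω a), Y ω := by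
    have hinj : ∀ ω₁ ∈ T, ∀ ω₂ ∈ T, ψ ω₁ = ψ ω₂ → ω₁ = ω₂ := by
      intro ω₁ h₁ ω₂ h₂ he
      obtain ⟨s1, r1, b1⟩ := hTmem.mp h₁
      obtain ⟨s2, r2, b2⟩ := hTmem.mp h₂
      exact hψinj ω₁ ω₂ s1 r1 b1 s2 r2 b2 he
    have e1 : ∑ ω ∈ T, Y (ψ ω) = ∑ ω' ∈ T.image ψ, Y ω' := (Finset.sum_image (f := fun ω' => Y ω') hinj).symm
    rw [e1]
    refine Finset.sum_le_sum_of_subset_of_nonneg ?_ (fun ω _ _ => hY0 ω)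
    intro ω' hω'
    rw [Finset.mem_image] at hω'
    obtain ⟨ω, hω, rfl⟩ := hω'
    obtain ⟨s1, r1, b1⟩ := hTmem.mp hω
    rw [Finset.mem_filter, Finset.mem_powerset]
    exact ⟨hψE ω s1 r1 b1, hψprop ω s1 r1 b1⟩
  rw [Finset.sum_add_distrib] at step
  have hYsum : ∑ ω ∈ E.powerset.filter (fun ω : Finset ι => b ∉ C ω a), h (C ω a ∪ C ω b) * k (C ω a ∪ C ω b) =
      ∑ ω ∈ E.powerset.filter (fun ω : Finset ι => b ∉ C ω a), Y ω := rfl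
  rw [hYsum]
  linarith

open Classical in
/-- **KB-MIX at equal levels gives the core-class kernel.**  For a monotone `f` with `f ∅ = 0` and a monotone `g`, if
`0 ≤ Σ_{ω ⊆ E : b ∉ C_a ω} f(S)(g S − g ∅) + Σ_{ω : b ∉ C_a ω, b ∉ C_a(E∖ω)} (f(C_a ω) − f(C_b(E∖ω)))((g(C_a ω) − g ∅) − (g(C_b(E∖ω)) − g ∅))`
(`S = C_a ω ∪ C_b ω`), then the core-class kernel of `(E; a, b)` is nonnegative:
`0 ≤ Σ_{ω ⊆ E} f(S)(g S − g ∅) + Σ_{ω : b ∉ C_a ω, b ∉ C_a(E∖ω)} [f(C_a ω)(g(C_a ω) − g(C_b(E∖ω))) + f(C_b ω)(g(C_b ω) − g(C_a(E∖ω)))]`.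
[cite: KozmaNitzan2024, Questions 8–9 (§5.5 p. 36) (context)] -/
theorem coreClass_kernel_nonneg_of_kernelMix (ends : ι → Sym2 V) (E : Finset ι) (a b : V) (f g : Set V → ℝ)
    (hf : Monotone f) (hf0 : f ∅ = 0) (hg : Monotone g)
    (hmix : 0 ≤ (∑ ω ∈ E.powerset.filter (fun ω : Finset ι => b ∉ openCluster (ends '' (↑ω : Set ι)) a),
        f (openCluster (ends '' (↑ω : Set ι)) a ∪ openCluster (ends '' (↑ω : Set ι)) b) *
          (g (openCluster (ends '' (↑ω : Set ι)) a ∪ openCluster (ends '' (↑ω : Set ι)) b) - g ∅))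
      + ∑ ω ∈ E.powerset.filter (fun ω : Finset ι => b ∉ openCluster (ends '' (↑ω : Set ι)) a ∧ b ∉ openCluster (ends '' (↑(E \ ω) : Set ι)) a),
        (f (openCluster (ends '' (↑ω : Set ι)) a) - f (openCluster (ends '' (↑(E \ ω) : Set ι)) b)) *
          ((g (openCluster (ends '' (↑ω : Set ι)) a) - g ∅) - (g (openCluster (ends '' (↑(E \ ω) : Set ι)) b) - g ∅))) :
    0 ≤ (∑ ω ∈ E.powerset,
        f (openCluster (ends '' (↑ω : Set ι)) a ∪ openCluster (ends '' (↑ω : Set ι)) b) *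
          (g (openCluster (ends '' (↑ω : Set ι)) a ∪ openCluster (ends '' (↑ω : Set ι)) b) - g ∅))
      + ∑ ω ∈ E.powerset.filter (fun ω : Finset ι => b ∉ openCluster (ends '' (↑ω : Set ι)) a ∧ b ∉ openCluster (ends '' (↑(E \ ω) : Set ι)) a),
        (f (openCluster (ends '' (↑ω : Set ι)) a) * (g (openCluster (ends '' (↑ω : Set ι)) a) - g (openCluster (ends '' (↑(E \ ω) : Set ι)) b))
          + f (openCluster (ends '' (↑ω : Set ι)) b) * (g (openCluster (ends '' (↑ω : Set ι)) b) - g (openCluster (ends '' (↑(E \ ω) : Set ι)) a))) := by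
  set C : Finset ι → V → Set V := fun ω v => openCluster (ends '' (↑ω : Set ι)) v with hC
  set D : Finset (Finset ι) := E.powerset.filter (fun ω => b ∉ C ω a ∧ b ∉ C (E \ ω) a) with hD
  change 0 ≤ (∑ ω ∈ E.powerset, f (C ω a ∪ C ω b) * (g (C ω a ∪ C ω b) - g ∅)) +
    ∑ ω ∈ D, (f (C ω a) * (g (C ω a) - g (C (E \ ω) b)) + f (C ω b) * (g (C ω b) - g (C (E \ ω) a)))
  change 0 ≤ (∑ ω ∈ E.powerset.filter (fun ω : Finset ι => b ∉ C ω a), f (C ω a ∪ C ω b) * (g (C ω a ∪ C ω b) - g ∅)) +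
    ∑ ω ∈ D, (f (C ω a) - f (C (E \ ω) b)) * ((g (C ω a) - g ∅) - (g (C (E \ ω) b) - g ∅)) at hmix
  have hf_nonneg : ∀ X : Set V, 0 ≤ f X := fun X => by rw [← hf0]; exact hf (Set.empty_subset X)
  have hk_nonneg : ∀ X : Set V, 0 ≤ g X - g ∅ := fun X => by linarith [hg (Set.empty_subset X)]
  -- symmetrise the second anti term by the colour swap
  have hswap : ∑ ω ∈ D, f (C ω b) * (g (C ω b) - g (C (E \ ω) a)) = ∑ ω ∈ D, f (C (E \ ω) b) * (g (C (E \ ω) b) - g (C ω a)) := by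
    have h := sum_powerset_filter_sdiff E (fun ω : Finset ι => b ∉ C ω a ∧ b ∉ C (E \ ω) a)
      (fun s hs => by rw [Finset.sdiff_sdiff_eq_self hs]; exact and_comm) (fun ω => f (C ω b) * (g (C ω b) - g (C (E \ ω) a)))
    rw [hD, ← h]
    refine Finset.sum_congr rfl fun ω hω => ?_
    rw [Finset.mem_filter, Finset.mem_powerset] at hω
    rw [Finset.sdiff_sdiff_eq_self hω.1]
  rw [Finset.sum_add_distrib, hswap, ← Finset.sum_add_distrib]
  have hsym : ∀ ω, f (C ω a) * (g (C ω a) - g (C (E \ ω) b)) + f (C (E \ ω) b) * (g (C (E \ ω) b) - g (C ω a)) =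
      (f (C ω a) - f (C (E \ ω) b)) * ((g (C ω a) - g ∅) - (g (C (E \ ω) b) - g ∅)) := fun ω => by ring
  simp only [hsym]
  -- the full Harris sum dominates its part off `ℜ`
  have hsub : ∑ ω ∈ E.powerset.filter (fun ω : Finset ι => b ∉ C ω a), f (C ω a ∪ C ω b) * (g (C ω a ∪ C ω b) - g ∅) ≤
      ∑ ω ∈ E.powerset, f (C ω a ∪ C ω b) * (g (C ω a ∪ C ω b) - g ∅) :=
    Finset.sum_le_sum_of_subset_of_nonneg (Finset.filter_subset _ _) (fun ω _ _ => mul_nonneg (hf_nonneg _) (hk_nonneg _))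
  linarith

end Coefficientwise

end Summit.CriticalPhenomena.PercolationContinuityZ3.Theorems
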